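import Summits.HodgeConjecture.HodgeConjecture.Theorems.F0P2cStubCI                    -- ★ p800717 F0P2-p02 (g2): `lemD1_1AsPrinted_chi`, `surjective_of_pinned`, `rhoAtLine_chi_isIrreducible` (general CM frames)
import Summits.HodgeConjecture.HodgeConjecture.Theorems.A3Liu413StubFTF2iffOfFloor     -- ★ p641242 B-p14: `lemD1_3AsPrintedI_famAtV_holds` ([Lem. D.1 (3)] per place, ZERO hypotheses; ⊇ ★ HD3 chain, `famAtV`, `LocalDataAtV`)
import Literature.NumberTheory.Automorphic.Liu2021.Def411WeilCarriersAtLineReindex      -- ★ `exists_omegaAtLine_equiv_rhoVAtLine_reindex` (enumeration independence of the carriers)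
import Literature.NumberTheory.GaloisRepresentations.HeckeCharacterWeakApproximation   -- ★ `HeckeCharacter.eq_one_of_forall_localUnits` (density of `K^×·𝕀_K^S`)
import Literature.NumberTheory.GelbartRogawski1991.CMSplittingCharLocalMu                -- ★ `localMu`, `localMu_apply`
import Literature.NumberTheory.Automorphic.IdeleClassCharacterHecke                     -- ★ `toHeckeCharacter_injective`
import Literature.RepresentationTheory.Semisimple.Multiplicity                         -- ★ `Representation.nontrivial_of_isIrreducible`
import HarnessLib

/-!
# Crux `H413` · programme P2 · E3 rung 3 — STUB **RIG-μ** CLOSED, LETTER-FREE: μ-RIGIDITY OF EQUIVALENT THETA CARRIERS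
# `stubRigMu_holds : ‹StubThetaCarrierMuRigidity›` (body of `Cruxes/H413/Lines/F0_P2E3Rung3.lean` v1 §1 :411 VERBATIM)

Cell hodgecm-mathlib (D-0151), FLOOR 0, crux item H413 = stmt-HodgeConjecture-24833; sub-line `Cruxes/H413/Lines/F0_P2E3Rung3.lean` v1
(F0P2-plan (g7) 2026-08-31T11:58Z, 809baa7acc4bedcc; registered stub `stub_thetaCarrier_muRigidity : StubThetaCarrierMuRigidity` :565).  Author
F0P2-p01 (g6) (row RIG-μ, F0P2-plan (g7) 11:58:20Z).  THEOREMS ONLY (no `def`, no instance, no notation, no named fact, no `sorry`); kernel lane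
`--supports stmt-HodgeConjecture-24833 --as helper`; never imports a `Cruxes/…/Lines` module (O50-1) — the registered text is PASTED VERBATIM as the type.
HONEST LABEL: HC_CM is proved only modulo the printed citations until rung 0 closes; this file discharges NO printed citation and introduces none: RIG-μ is
not a letter — it is [Liu2021, App. D Lem. D.1 (3)] («for `n ≥ 3`, `ω(μ′,ε′,χ′) ≅ ω(μ,ε,χ)` iff `(μ′,ε′,χ′) = (μ,ε,χ)`», its `μ`-leg) read place by
place on the tree's CONSTRUCTED carriers, which the tree PROVES (crux HD3 ★ `HD3_proof`, made frame-generic by B-p14's ★ `lemD1_3AsPrintedI_famAtV_holds`),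
plus «a Hecke character is determined by its local components» (Cassels–Fröhlich VII §4 Prop. 4.1, ★ `HeckeCharacter.eq_one_of_forall_localUnits`).

THE STATEMENT (`StubThetaCarrierMuRigidity`, :411): for a CM field `L`, a hermitian `H`, any enumeration `e₁ : Fin 3 × Fin 1 ≃ Fin n'`, a real
non-degenerate diagonal frame `dV` with `g` (`ᵗḡ H g = diag dV`) and the finite-adelic frame transport `ιV` pinned by `ιV k = g_f⁻¹ k g_f`: if Liu's
carriers `ω_H(μ, a, χ)` and `ω_H(μ′, a′, χ′)` (`omegaAtLine … e₁ (diag dV) … (χ-attached splitting of μ) a χ`, [Liu2021, Def. 4.11]) admit a `ℂ`-linear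
equivalence intertwining `rhoAtLine … ιV a χ` and `rhoAtLine … ιV a′ χ′`, then `μ′ = μ`.

THE PROOF (every input ★, nothing assumed):
1. ENUMERATION: ★ `Def411WeilCarriersDoubling.exists_omegaAtLine_equiv_rhoVAtLine_reindex` moves the given equivalence from `e₁` to the tree's fixed
   enumeration `HodgeCM.Model.ArchSideTerm.e₁ = Equiv.prodUnique (Fin 3) (Fin 1)` (both carriers; `rhoAtLine ι = rhoVAtLine ∘ ι`, rfl).
2. RESTRICTION + LOCAL RIGIDITY: ✔ `Def411WeilCarriers.forall_localMu_eq_of_equiv_of_lemD1AsPrintedI` (`Liu2021/Def411WeilCarriersLocalDataAtV` §6) on the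
   TWO-MEMBER indexed family over `Bool` (`false ↦ (μ, a, χ)`, `true ↦ (μ′, a′, χ′)`; splittings ★ `OmegaChiSplitting.hsChiD ∕ chiLocalSplittingsD ∕ hfac_sChiD`,
   local characters `localMu (toHeckeCharacter μ_•)`) — this family IS `A4LiuD3.famAtV ⟨L⟩ e₁ dV … v` (δ) — fed with: [Lem. D.1 (3)] AS PRINTED at every place
   ★ `Theorems.lemD1_3AsPrintedI_famAtV_holds` (ZERO hypotheses: the HD3 chain ★ `rankOne_theta_twist_rigidity_holds`, ★ `…lines_disjoint_holds`,
   ★ `…split_holds`, ★ S6a `HypD3.lineRigidityS6a`, ★ Kudla transport — [MoeglinVignerasWaldspurger1987, Chap. 3 IV.4], [Kudla1994, Thm. 3.1],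
   [Minguez2008, Thm. 1], [GelbartRogawski1990, Prop. 5.1.4]); [Lem. D.1 (1)] AS PRINTED at every place and member ★ `F0P2cStubCI.lemD1_1AsPrinted_chi`; `ιV` onto
   ★ `F0P2cStubCI.surjective_of_pinned`; the carrier non-zero (★ `F0P2cStubCI.rhoAtLine_chi_isIrreducible` + `Representation.nontrivial_of_isIrreducible`).
   Output: `localMu (toHeckeCharacter μ) v = localMu (toHeckeCharacter μ′) v` at EVERY finite place `v` of `L⁺`.
3. GLOBAL PATCH (§1): `μ_v` at the unit supported at one `w ∣ v` is `χ_w` (`localMu_apply`), so the two Hecke characters have equal local components at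
   every finite place of `L`, hence are equal (★ `HeckeCharacter.eq_one_of_forall_localUnits`, `S = ∅`); ★ `toHeckeCharacter_injective` returns to
   `IdeleClassGroup L →ₜ* Circle`.
WHY IT MIGHT HAVE FAILED: only for `n ≤ 2` ([Liu2021, Lem. D.1 (3)] second clause) — excluded, `N = 3`.

## References
* [Liu2021] Y. Liu, *Fourier–Jacobi cycles and arithmetic relative trace formula*, Camb. J. Math. 9 (2021) = arXiv:2102.11518: Def. 4.11 (l. 2083–2097),
  App. D §D.1 Steps 1–3 (l. 5213–5224), Lem. D.1 (1), (3) (l. 5229, 5233), proof l. 5249–5255; Thm. 4.18 (2) proof l. 2270; Prop. 4.13 summary l. 2147.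
* [MoeglinVignerasWaldspurger1987] LNM 1291, Chap. 3 IV.4.  [Kudla1994] Israel J. Math. 87, §3 Thm. 3.1.  [GelbartRogawski1990] Prop. 5.1.4.  [Minguez2008] Thm. 1.
* [CasselsFrohlichANT1967] Ch. II §10–§11; Ch. VII (Tate) §4 Prop. 4.1.  [FlathCorvallis1979] Theorem 3.
-/

set_option autoImplicit false

-- the mandated namespace has the single-problem summit's repeated segment (`HodgeConjecture.HodgeConjecture`)
set_option linter.dupNamespace false

noncomputable section

namespace Summit.HodgeConjecture.HodgeConjecture.Cruxes.H413.F0P2mRigMu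

open scoped Matrix TensorProduct ComplexOrder
open NumberField NumberField.InfinitePlace IsDedekindDomain MeasureTheory
open Literature.NumberTheory Literature.NumberTheory.Automorphic Literature.NumberTheory.Automorphic.UnitaryGroup
open Literature.NumberTheory.Automorphic.Liu2021 Literature.NumberTheory.Automorphic.Liu2021.AppendixC
open Literature.NumberTheory.Automorphic.Liu2021.Def411WeilCarriers
open Literature.NumberTheory.Automorphic.Liu2021.Def411WeilCarriersDoubling
open Literature.NumberTheory.Automorphic.IdeleClassGroup
open Literature.NumberTheory.GelbartRogawski1991 Literature.NumberTheory.GelbartRogawski1991.UnitaryDualPair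
open Literature.NumberTheory.GelbartRogawski1991.UnitaryDualPair.WeilCoinv
open Literature.NumberTheory.GelbartRogawski1991.UnitaryDualPair.LocalSplitting (localMu localMu_apply norm_localMu continuous_localMu localMu_toLocalRing_eq_one_iff)
open Literature.NumberTheory.GaloisRepresentations (HeckeCharacter localUnits)
open Literature.RepresentationTheory Literature.RepresentationTheory.Liu2021
open Summit.HodgeConjecture.CorCM
open Summit.HodgeConjecture.CorCM.Transposition
open Summit.HodgeConjecture.CorCM.Lines.A4LiuD3 (famAtV)

/-! ## §1 The global patch: a Hecke character is determined by its local components -/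

/-- **Hecke characters with the same local component at every finite place are equal** — `K^× · ∏_v K_vˣ` is dense in the
idèles: ★ `HeckeCharacter.eq_one_of_forall_localUnits` (Cassels–Fröhlich VII §4 Prop. 4.1, uniqueness half, empty exceptional set)
applied to `χ₁ · χ₂⁻¹`. [cite: CasselsFrohlichANT1967, Ch. VII §4 Prop. 4.1 (proof, uniqueness)] -/
theorem heckeCharacter_eq_of_forall_localComponent_eq {K : Type} [Field K] [NumberField K] (χ₁ χ₂ : HeckeCharacter K)
    (h : ∀ (v : HeightOneSpectrum (𝓞 K)) (u : (v.adicCompletion K)ˣ), χ₁.localComponent v u = χ₂.localComponent v u) :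
    χ₁ = χ₂ := by
  have key : χ₁ * χ₂⁻¹ = 1 :=
    HeckeCharacter.eq_one_of_forall_localUnits (S := ∅) fun v _ u => by
      rw [HeckeCharacter.mul_apply, HeckeCharacter.inv_apply, ← HeckeCharacter.localComponent_apply,
        ← HeckeCharacter.localComponent_apply, h v u, mul_inv_cancel]
  exact mul_inv_eq_one.mp key

/-- **A Hecke character of the CM field `L` is determined by its components `μ_v = ∏_{w ∣ v} χ_w` at the finite places `v` of `L⁺`**
([Liu2021, Def. 4.11 (l. 2086)] «`μ = ⊗ μ_v`»): every finite place `w` of `L` lies over `v := w ∩ 𝓞_{L⁺}`, and `μ_v` evaluated at the unit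
supported at `w` is `χ_w`. [cite: Liu2021, Def. 4.11 (l. 2086); App. D §D.1 Step 2 (l. 5219)] [cite: CasselsFrohlichANT1967, Ch. II §10–§11; Ch. VII §4 Prop. 4.1] -/
theorem heckeCharacter_eq_of_forall_localMu_eq (L : Type) [Field L] [NumberField L] [IsCMField L] (χ₁ χ₂ : HeckeCharacter L)
    (h : ∀ v : HeightOneSpectrum (𝓞 ↥(maximalRealSubfield L)), localMu L χ₁ v = localMu L χ₂ v) : χ₁ = χ₂ := by
  classical
  refine heckeCharacter_eq_of_forall_localComponent_eq χ₁ χ₂ fun w u => ?_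
  -- `w` lies over `v := w ∩ 𝓞_{L⁺}`
  let v : HeightOneSpectrum (𝓞 ↥(maximalRealSubfield L)) := w.under (𝓞 ↥(maximalRealSubfield L))
  let W : PlacesOver L v := ⟨w, rfl⟩
  -- the unit of `E_v = ∏_{w' ∣ v} L_{w'}` supported at `w`
  let x : (LocalRing L v)ˣ :=
    Units.map (MonoidHom.mulSingle (fun w' : PlacesOver L v => w'.1.adicCompletion L) W) u
  have hx : ∀ w' : PlacesOver L v,
      Units.map (Pi.evalMonoidHom (fun w' : PlacesOver L v => w'.1.adicCompletion L) w') x =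
        Pi.mulSingle (M := fun w' : PlacesOver L v => (w'.1.adicCompletion L)ˣ) W u w' := by
    intro w'
    apply Units.ext
    change (Pi.mulSingle (M := fun w' : PlacesOver L v => w'.1.adicCompletion L) W (u : W.1.adicCompletion L)) w' =
      ((Pi.mulSingle (M := fun w' : PlacesOver L v => (w'.1.adicCompletion L)ˣ) W u w' :
        (w'.1.adicCompletion L)ˣ) : w'.1.adicCompletion L)
    exact (Pi.apply_mulSingle (fun (i : PlacesOver L v) (y : (i.1.adicCompletion L)ˣ) => (y : i.1.adicCompletion L))
      (fun _ => rfl) W u w').symm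
  have hev : ∀ χ : HeckeCharacter L, localMu L χ v x = χ.localComponent w u := by
    intro χ
    rw [localMu_apply, Finset.prod_eq_single W]
    · rw [hx W, Pi.mulSingle_eq_same]; rfl
    · intro w' _ hw'
      rw [hx w', Pi.mulSingle_eq_of_ne hw', map_one, map_one]
    · intro hW; exact absurd (Finset.mem_univ W) hW
  rw [← hev χ₁, ← hev χ₂, h v]

/-! ## §2 RIG-μ — the registered text as type, VERBATIM (`Lines/F0_P2E3Rung3.lean` v1 :411–468) -/

set_option synthInstance.maxHeartbeats 400000 in
set_option maxHeartbeats 16000000 in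
/-- **RIG-μ HOLDS — `μ`-rigidity of equivalent theta carriers `ω_H(μ, a, χ) ≃ ω_H(μ′, a′, χ′) ⟹ μ′ = μ`**, for every CM frame, LETTER-FREE:
[Liu2021, App. D Lem. D.1 (3)] per place is ★ `lemD1_3AsPrintedI_famAtV_holds` (HD3 chain), the restriction step is ✔
`forall_localMu_eq_of_equiv_of_lemD1AsPrintedI`, the enumeration is moved by ★ `exists_omegaAtLine_equiv_rhoVAtLine_reindex`, and the local
components determine the character (§1).  Type = the body of `F0P2E3Rung3.StubThetaCarrierMuRigidity` VERBATIM (the sub-line folds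
`stub_thetaCarrier_muRigidity := F0P2mRigMu.stubRigMu_holds`). [cite: Liu2021, App. D Lem. D.1 (3) (l. 5233), §D.1 Steps 1–3; Def. 4.11 (l. 2086); Prop. 4.13 summary (l. 2147)]
[cite: MoeglinVignerasWaldspurger1987, Chap. 3 IV.4] [cite: Kudla1994, Thm. 3.1] [cite: CasselsFrohlichANT1967, Ch. VII §4 Prop. 4.1] -/
theorem stubRigMu_holds :
    ∀ (L : Type) [Field L] [NumberField L] [IsCMField L] (H : Matrix (Fin 3) (Fin 3) L),
      ∀ {n' : ℕ} (e₁ : Fin 3 × Fin 1 ≃ Fin n') (dV : Fin 3 → L) (hdV : ∀ i, IsCMField.complexConj L (dV i) = dV i)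
        (hdV0 : ∀ i, dV i ≠ 0) (g : GL (Fin 3) L)
        (hg : ((g : Matrix (Fin 3) (Fin 3) L).map (cmConjRingHom L))ᵀ * H * (g : Matrix (Fin 3) (Fin 3) L) = Matrix.diagonal dV)
        (ιV : finAdelic (↥(maximalRealSubfield L)) L (IsCMField.complexConj L) 3 H →*
            finAdelic (↥(maximalRealSubfield L)) L (IsCMField.complexConj L) 3 (Matrix.diagonal dV)),
          (∀ k, ((ιV k : finAdelic (↥(maximalRealSubfield L)) L (IsCMField.complexConj L) 3 (Matrix.diagonal dV)) :
              GL (Fin 3) (FiniteAdeleRing (𝓞 L) L)) =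
            (toFinAdeleGL L 3 g)⁻¹ * (k : GL (Fin 3) (FiniteAdeleRing (𝓞 L) L)) * toFinAdeleGL L 3 g) →
          ∀ (μ : Literature.NumberTheory.Automorphic.IdeleClassGroup L →ₜ* Circle) (hμ : IsConjugateSymplectic L μ) (a : (↥(maximalRealSubfield L))ˣ) (χ : Chi (↥(maximalRealSubfield L)) L (IsCMField.complexConj L))
            (μ' : Literature.NumberTheory.Automorphic.IdeleClassGroup L →ₜ* Circle) (hμ' : IsConjugateSymplectic L μ') (a' : (↥(maximalRealSubfield L))ˣ) (χ' : Chi (↥(maximalRealSubfield L)) L (IsCMField.complexConj L)),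
            (
                ∃ f :
                    (omegaAtLine (↥(maximalRealSubfield L)) L (IsCMField.complexConj L) 3 e₁ (Matrix.diagonal dV)
                      (complexConj_imagUnit L) (imagUnit_ne_zero L) (imagUnit_mul_self L) (realDiagonal_isSymm L dV hdV)
                      (isUnit_det_realDiagonal L dV hdV hdV0) (realDiagonal_map L dV hdV).symm
                      (fun a => isCompatible_chiSplittingLine L e₁ dV hdV hdV0 (toHeckeCharacter L μ)
                        (isUnitary_toHeckeCharacter L μ) ((isOscillatorChar_toHeckeCharacter_iff μ).mpr hμ)
                        (TW (↥(maximalRealSubfield L)) a) (isSymm_TW (↥(maximalRealSubfield L)) a)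
                        (isUnit_det_TW (↥(maximalRealSubfield L)) a) (JW (↥(maximalRealSubfield L)) L a)
                        (JW_eq (↥(maximalRealSubfield L)) L a)) a χ) ≃ₗ[ℂ]
                    (omegaAtLine (↥(maximalRealSubfield L)) L (IsCMField.complexConj L) 3 e₁ (Matrix.diagonal dV)
                      (complexConj_imagUnit L) (imagUnit_ne_zero L) (imagUnit_mul_self L) (realDiagonal_isSymm L dV hdV)
                      (isUnit_det_realDiagonal L dV hdV hdV0) (realDiagonal_map L dV hdV).symm
                      (fun a => isCompatible_chiSplittingLine L e₁ dV hdV hdV0 (toHeckeCharacter L μ')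
                        (isUnitary_toHeckeCharacter L μ') ((isOscillatorChar_toHeckeCharacter_iff μ').mpr hμ')
                        (TW (↥(maximalRealSubfield L)) a) (isSymm_TW (↥(maximalRealSubfield L)) a)
                        (isUnit_det_TW (↥(maximalRealSubfield L)) a) (JW (↥(maximalRealSubfield L)) L a)
                        (JW_eq (↥(maximalRealSubfield L)) L a)) a' χ'),
                  ∀ (k : finAdelic (↥(maximalRealSubfield L)) L (IsCMField.complexConj L) 3 H)
                    (x :
                    (omegaAtLine (↥(maximalRealSubfield L)) L (IsCMField.complexConj L) 3 e₁ (Matrix.diagonal dV)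
                      (complexConj_imagUnit L) (imagUnit_ne_zero L) (imagUnit_mul_self L) (realDiagonal_isSymm L dV hdV)
                      (isUnit_det_realDiagonal L dV hdV hdV0) (realDiagonal_map L dV hdV).symm
                      (fun a => isCompatible_chiSplittingLine L e₁ dV hdV hdV0 (toHeckeCharacter L μ)
                        (isUnitary_toHeckeCharacter L μ) ((isOscillatorChar_toHeckeCharacter_iff μ).mpr hμ)
                        (TW (↥(maximalRealSubfield L)) a) (isSymm_TW (↥(maximalRealSubfield L)) a)
                        (isUnit_det_TW (↥(maximalRealSubfield L)) a) (JW (↥(maximalRealSubfield L)) L a)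
                        (JW_eq (↥(maximalRealSubfield L)) L a)) a χ)),
                    f (
                    (rhoAtLine (↥(maximalRealSubfield L)) L (IsCMField.complexConj L) 3 e₁ (Matrix.diagonal dV)
                      (complexConj_imagUnit L) (imagUnit_ne_zero L) (imagUnit_mul_self L) (realDiagonal_isSymm L dV hdV)
                      (isUnit_det_realDiagonal L dV hdV hdV0) (realDiagonal_map L dV hdV).symm
                      (fun a => isCompatible_chiSplittingLine L e₁ dV hdV hdV0 (toHeckeCharacter L μ)
                        (isUnitary_toHeckeCharacter L μ) ((isOscillatorChar_toHeckeCharacter_iff μ).mpr hμ)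
                        (TW (↥(maximalRealSubfield L)) a) (isSymm_TW (↥(maximalRealSubfield L)) a)
                        (isUnit_det_TW (↥(maximalRealSubfield L)) a) (JW (↥(maximalRealSubfield L)) L a)
                        (JW_eq (↥(maximalRealSubfield L)) L a)) ιV a χ) k x) =
                    (rhoAtLine (↥(maximalRealSubfield L)) L (IsCMField.complexConj L) 3 e₁ (Matrix.diagonal dV)
                      (complexConj_imagUnit L) (imagUnit_ne_zero L) (imagUnit_mul_self L) (realDiagonal_isSymm L dV hdV)
                      (isUnit_det_realDiagonal L dV hdV hdV0) (realDiagonal_map L dV hdV).symm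
                      (fun a => isCompatible_chiSplittingLine L e₁ dV hdV hdV0 (toHeckeCharacter L μ')
                        (isUnitary_toHeckeCharacter L μ') ((isOscillatorChar_toHeckeCharacter_iff μ').mpr hμ')
                        (TW (↥(maximalRealSubfield L)) a) (isSymm_TW (↥(maximalRealSubfield L)) a)
                        (isUnit_det_TW (↥(maximalRealSubfield L)) a) (JW (↥(maximalRealSubfield L)) L a)
                        (JW_eq (↥(maximalRealSubfield L)) L a)) ιV a' χ') k (f x)) →
              μ' = μ := by
  intro L _ _ _ H n' e dV hdV hdV0 g hg ιV hιV μ hμ a χ μ' hμ' a' χ' hst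
  -- Step 1 — move the equivalence to the tree's fixed enumeration `e₁ = Equiv.prodUnique (Fin 3) (Fin 1)`
  obtain ⟨Ψ, -, hΨ⟩ := exists_omegaAtLine_equiv_rhoVAtLine_reindex L e HodgeCM.Model.ArchSideTerm.e₁ dV hdV hdV0
    (toHeckeCharacter L μ) (isUnitary_toHeckeCharacter L μ) ((isOscillatorChar_toHeckeCharacter_iff μ).mpr hμ) a χ
  obtain ⟨Ψ', -, hΨ'⟩ := exists_omegaAtLine_equiv_rhoVAtLine_reindex L e HodgeCM.Model.ArchSideTerm.e₁ dV hdV hdV0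
    (toHeckeCharacter L μ') (isUnitary_toHeckeCharacter L μ') ((isOscillatorChar_toHeckeCharacter_iff μ').mpr hμ') a' χ'
  obtain ⟨f, hf⟩ := hst
  -- `Ψ′ ∘ f ∘ Ψ⁻¹` intertwines the two actions at `e₁` (every `rhoAtLine ιV` is `rhoVAtLine ∘ ιV`, rfl)
  have hf' : ∀ k x, f (rhoVAtLine _ _ _ _ _ _ _ _ _ _ _ _ _ a χ (ιV k) x) =
      rhoVAtLine _ _ _ _ _ _ _ _ _ _ _ _ _ a' χ' (ιV k) (f x) := fun k x => hf k x
  have hst₁ : ∀ k x, ((Ψ.symm.trans f).trans Ψ') (rhoVAtLine _ _ _ _ _ _ _ _ _ _ _ _ _ a χ (ιV k) x) =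
      rhoVAtLine _ _ _ _ _ _ _ _ _ _ _ _ _ a' χ' (ιV k) (((Ψ.symm.trans f).trans Ψ') x) := by
    intro k x
    obtain ⟨y, rfl⟩ := Ψ.surjective x
    simp only [LinearEquiv.trans_apply]
    rw [← hΨ, LinearEquiv.symm_apply_apply, LinearEquiv.symm_apply_apply, hf', hΨ']
  -- the carrier `ω_H(μ, a, χ)` at `e₁` is non-zero (irreducible, ★ CI road)
  have hnt := @Literature.RepresentationTheory.Semisimple.Representation.nontrivial_of_isIrreducible _ _ _ _ _ _ _ _
    (F0P2cStubCI.rhoAtLine_chi_isIrreducible L H HodgeCM.Model.ArchSideTerm.e₁ dV hdV hdV0 g hg ιV hιV μ hμ a χ)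
  -- Step 2 — [Lem. D.1 (3)] AS PRINTED per place (★, frame-generic) on the two-member family `false ↦ (μ,a,χ)`, `true ↦ (μ′,a′,χ′)`,
  -- through the restriction step: equality of the local characters `μ_v` at every finite place `v` of `L⁺`
  have hloc : ∀ v : HeightOneSpectrum (𝓞 ↥(maximalRealSubfield L)),
      localMu L (toHeckeCharacter L μ) v = localMu L (toHeckeCharacter L μ') v := fun v =>
    forall_localMu_eq_of_equiv_of_lemD1AsPrintedI (↥(maximalRealSubfield L)) L (IsCMField.complexConj L) 3
      HodgeCM.Model.ArchSideTerm.e₁ (Matrix.diagonal dV) (complexConj_imagUnit L) (imagUnit_ne_zero L) (imagUnit_mul_self L)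
      (realDiagonal_isSymm L dV hdV) (isUnit_det_realDiagonal L dV hdV hdV0) (realDiagonal_map L dV hdV).symm (le_refl 3)
      (fun b => (cond b a' a)) (fun b => (cond b χ' χ))
      (fun b => OmegaChiSplitting.chiLocalSplittingsD ⟨L⟩ HodgeCM.Model.ArchSideTerm.e₁ dV hdV hdV0 (toHeckeCharacter L (cond b μ' μ))
        ((isOscillatorChar_toHeckeCharacter_iff (cond b μ' μ)).mpr (Bool.rec (motive := fun b => IsConjugateSymplectic L (cond b μ' μ)) hμ hμ' b)) (cond b a' a))
      (fun b => localMu L (toHeckeCharacter L (cond b μ' μ)))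
      (fun b v x => norm_localMu L (toHeckeCharacter L (cond b μ' μ)) v (isUnitary_toHeckeCharacter L (cond b μ' μ)) x)
      (fun b => continuous_localMu L (toHeckeCharacter L (cond b μ' μ)))
      (fun b v t => localMu_toLocalRing_eq_one_iff L (toHeckeCharacter L (cond b μ' μ)) v
        ((isOscillatorChar_toHeckeCharacter_iff (cond b μ' μ)).mpr (Bool.rec (motive := fun b => IsConjugateSymplectic L (cond b μ' μ)) hμ hμ' b)) t)
      (fun b => OmegaChiSplitting.hsChiD ⟨L⟩ HodgeCM.Model.ArchSideTerm.e₁ dV hdV hdV0 (toHeckeCharacter L (cond b μ' μ))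
        (isUnitary_toHeckeCharacter L (cond b μ' μ)) ((isOscillatorChar_toHeckeCharacter_iff (cond b μ' μ)).mpr (Bool.rec (motive := fun b => IsConjugateSymplectic L (cond b μ' μ)) hμ hμ' b)))
      (fun b => OmegaChiSplitting.hfac_sChiD ⟨L⟩ HodgeCM.Model.ArchSideTerm.e₁ dV hdV hdV0 (toHeckeCharacter L (cond b μ' μ))
        (isUnitary_toHeckeCharacter L (cond b μ' μ)) ((isOscillatorChar_toHeckeCharacter_iff (cond b μ' μ)).mpr (Bool.rec (motive := fun b => IsConjugateSymplectic L (cond b μ' μ)) hμ hμ' b)) (cond b a' a))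
      (fun b v => F0P2cStubCI.lemD1_1AsPrinted_chi L HodgeCM.Model.ArchSideTerm.e₁ dV hdV hdV0 (le_refl 3) (cond b μ' μ) (Bool.rec (motive := fun b => IsConjugateSymplectic L (cond b μ' μ)) hμ hμ' b) (cond b a' a) (cond b χ' χ) v)
      (fun v => Summit.HodgeConjecture.HodgeConjecture.Theorems.lemD1_3AsPrintedI_famAtV_holds ⟨L⟩ dV hdV hdV0
        (fun b => cond b μ' μ) (fun b => (Bool.rec (motive := fun b => IsConjugateSymplectic L (cond b μ' μ)) hμ hμ' b)) (fun b => cond b a' a) (fun b => cond b χ' χ) v)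
      (F0P2cStubCI.surjective_of_pinned L H dV g hg ιV hιV) false true hnt
      ⟨(Ψ.symm.trans f).trans Ψ', fun k x => hst₁ k x⟩ v
  -- Step 3 — the global patch (§1)
  exact (toHeckeCharacter_injective L (heckeCharacter_eq_of_forall_localMu_eq L _ _ hloc)).symm

end Summit.HodgeConjecture.HodgeConjecture.Cruxes.H413.F0P2mRigMu

end
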